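import Summits.AnomalousDissipation.AnomalousDissipation.Theorems.MarginalStabilityChainBurgersLayerKHLine

/-!
# Line `Sketch`, stub `stub_strained` (lead) — part A: resolvent calculus

Toolkit about Gaussian-class solutions of the resolvent equation `(λ + iU) ω - h·ou α ω = F`
(`IsResolventSol`, vocabulary of `MarginalStabilityChainBurgersLayerKHLine`): the profile `U`
(derivative `e^{-y²/2}`, `|U y| ≤ |y|`, `re(λ+iU) = re λ`), superposition / homogeneity / uniqueness
transfer (`resSol_add`, `resSol_smul`, `resSol_unique`), the RESOLVENT IDENTITY at the level of solutions
(`resSol_sub_param`), the decomposition `ω - F/(λ+iU) = h·ou(ω)/(λ+iU)` (`resSol_decomp`), and the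
Gaussian decay of `ω'` (`resSol_deriv_decay`, integrating factor `e^{t²/2}`), which makes the boundary
terms of the integration by parts in part B vanish.  Everything here is sorry-free and elementary.
-/

set_option linter.dupNamespace false

noncomputable section

open Complex MeasureTheory Filter Topology Set Metric intervalIntegral

namespace Summit.AnomalousDissipation.AnomalousDissipation.Theorems.BurgersLayerKH.Sheet.Strained

/-! ## §A The profile `U`: derivative and elementary bounds -/

/-- `U' = e^{-y²/2}`. [folklore] -/
theorem hasDerivAt_U (y : ℝ) : HasDerivAt U (Real.exp (-(y ^ 2) / 2)) y := by
  unfold U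
  exact intervalIntegral.integral_hasDerivAt_right
    ((by fun_prop : Continuous fun s : ℝ => Real.exp (-(s ^ 2) / 2)).intervalIntegrable _ _)
    ((by fun_prop : Continuous fun s : ℝ => Real.exp (-(s ^ 2) / 2)).stronglyMeasurableAtFilter _ _)
    (by fun_prop : Continuous fun s : ℝ => Real.exp (-(s ^ 2) / 2)).continuousAt

/-- `U` is differentiable. [folklore] -/
theorem differentiable_U : Differentiable ℝ U := fun y => (hasDerivAt_U y).differentiableAt

/-- `deriv U y = e^{-y²/2}`. [folklore] -/
theorem deriv_U (y : ℝ) : deriv U y = Real.exp (-(y ^ 2) / 2) := (hasDerivAt_U y).deriv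

/-- `|U y| ≤ |y|` (since `0 < U' ≤ 1`). [folklore] -/
theorem abs_U_le (y : ℝ) : |U y| ≤ |y| := by
  unfold U
  have h := intervalIntegral.norm_integral_le_of_norm_le_const (a := (0:ℝ)) (b := y) (C := 1)
    (f := fun s : ℝ => Real.exp (-(s ^ 2) / 2)) (fun s _ => by
      rw [Real.norm_eq_abs, abs_of_pos (Real.exp_pos _), Real.exp_le_one_iff]
      have : 0 ≤ s ^ 2 := sq_nonneg s
      linarith)
  simpa using h

/-- `re (λ + iU y) = re λ`. [folklore] -/
theorem re_lam_add (lam : ℂ) (y : ℝ) : (lam + I * U y).re = lam.re := by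
  simp [Complex.add_re, Complex.mul_re]

/-- `‖λ + iU y‖ ≥ re λ`. [folklore] -/
theorem re_le_norm_lam_add (lam : ℂ) (y : ℝ) : lam.re ≤ ‖lam + I * U y‖ := by
  have := Complex.re_le_norm (lam + I * U y)
  rwa [re_lam_add] at this

/-- `λ + iU y ≠ 0` when `re λ > 0`. [folklore] -/
theorem lam_add_ne_zero {lam : ℂ} (hlam : 0 < lam.re) (y : ℝ) : lam + I * U y ≠ 0 := by
  intro h
  have := re_le_norm_lam_add lam y
  rw [h, norm_zero] at this
  linarith

/-- `‖λ + iU y‖ ≤ ‖λ‖ + |y|`. [folklore] -/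
theorem norm_lam_add_le (lam : ℂ) (y : ℝ) : ‖lam + I * U y‖ ≤ ‖lam‖ + |y| := by
  calc ‖lam + I * U y‖ ≤ ‖lam‖ + ‖I * (U y : ℂ)‖ := norm_add_le _ _
    _ = ‖lam‖ + |U y| := by rw [norm_mul, Complex.norm_I, one_mul, Complex.norm_real, Real.norm_eq_abs]
    _ ≤ ‖lam‖ + |y| := by linarith [abs_U_le y]

/-! ## §B Algebra of the resolvent equation -/

/-- For a `C²` function, `iteratedDeriv 2 ω = deriv (deriv ω)`. [folklore] -/
theorem iteratedDeriv_two_eq (ω : ℝ → ℂ) : iteratedDeriv 2 ω = deriv (deriv ω) := by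
  rw [iteratedDeriv_succ, iteratedDeriv_one]

/-- Superposition: solutions of the resolvent equation add. [folklore] -/
theorem resSol_add {α h : ℝ} {lam : ℂ} {F₁ F₂ ω₁ ω₂ : ℝ → ℂ}
    (h₁ : IsResolventSol α h lam F₁ ω₁) (h₂ : IsResolventSol α h lam F₂ ω₂) :
    IsResolventSol α h lam (fun y => F₁ y + F₂ y) (fun y => ω₁ y + ω₂ y) := by
  obtain ⟨hc₁, ⟨C₁, hC₁⟩, he₁⟩ := h₁
  obtain ⟨hc₂, ⟨C₂, hC₂⟩, he₂⟩ := h₂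
  refine ⟨hc₁.add hc₂, ⟨C₁ + C₂, fun y => ?_⟩, fun y => ?_⟩
  · calc ‖ω₁ y + ω₂ y‖ ≤ ‖ω₁ y‖ + ‖ω₂ y‖ := norm_add_le _ _
      _ ≤ C₁ * Real.exp (-(y ^ 2) / 4) + C₂ * Real.exp (-(y ^ 2) / 4) := add_le_add (hC₁ y) (hC₂ y)
      _ = (C₁ + C₂) * Real.exp (-(y ^ 2) / 4) := by ring
  · have hd1 : Differentiable ℝ ω₁ := hc₁.differentiable (by norm_num)
    have hd2 : Differentiable ℝ ω₂ := hc₂.differentiable (by norm_num)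
    have hd1' : Differentiable ℝ (deriv ω₁) :=
      ((show ContDiff ℝ (1 + 1) ω₁ from hc₁).deriv').differentiable (by norm_num)
    have hd2' : Differentiable ℝ (deriv ω₂) :=
      ((show ContDiff ℝ (1 + 1) ω₂ from hc₂).deriv').differentiable (by norm_num)
    have hsum : (fun y => ω₁ y + ω₂ y) = ω₁ + ω₂ := rfl
    have e1 : deriv (fun y => ω₁ y + ω₂ y) y = deriv ω₁ y + deriv ω₂ y := by
      rw [hsum, deriv_add (hd1 y) (hd2 y)]
    have e2 : iteratedDeriv 2 (fun y => ω₁ y + ω₂ y) y = iteratedDeriv 2 ω₁ y + iteratedDeriv 2 ω₂ y := by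
      rw [iteratedDeriv_two_eq, iteratedDeriv_two_eq, iteratedDeriv_two_eq, hsum]
      have : deriv (ω₁ + ω₂) = deriv ω₁ + deriv ω₂ := by
        funext t; exact deriv_add (hd1 t) (hd2 t)
      rw [this, deriv_add (hd1' y) (hd2' y)]
    have := congrArg₂ (· + ·) (he₁ y) (he₂ y)
    simp only [ou] at this ⊢
    rw [e1, e2]
    linear_combination this

/-- Homogeneity: solutions of the resolvent equation scale. [folklore] -/
theorem resSol_smul {α h : ℝ} {lam : ℂ} {F ω : ℝ → ℂ} (hs : IsResolventSol α h lam F ω) (c : ℂ) :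
    IsResolventSol α h lam (fun y => c * F y) (fun y => c * ω y) := by
  obtain ⟨hc, ⟨C, hC⟩, he⟩ := hs
  refine ⟨contDiff_const.mul hc, ⟨‖c‖ * C, fun y => ?_⟩, fun y => ?_⟩
  · rw [norm_mul, mul_assoc]; exact mul_le_mul_of_nonneg_left (hC y) (norm_nonneg _)
  · have hd : Differentiable ℝ ω := hc.differentiable (by norm_num)
    have hcmul : (fun y => c * ω y) = fun y => c • ω y := rfl
    have e1 : deriv (fun y => c * ω y) y = c * deriv ω y := by
      simp [deriv_const_mul_field']
    have e2 : iteratedDeriv 2 (fun y => c * ω y) y = c * iteratedDeriv 2 ω y := by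
      rw [iteratedDeriv_two_eq, iteratedDeriv_two_eq]
      have : deriv (fun y => c * ω y) = fun y => c * deriv ω y := by
        funext t; simp [deriv_const_mul_field']
      rw [this]; simp [deriv_const_mul_field']
    have := congrArg (c * ·) (he y)
    simp only [ou] at this ⊢
    rw [e1, e2]
    linear_combination this

/-- Difference of two solutions with the same source solves the homogeneous equation. [folklore] -/
theorem resSol_sub_same {α h : ℝ} {lam : ℂ} {F ω₁ ω₂ : ℝ → ℂ}
    (h₁ : IsResolventSol α h lam F ω₁) (h₂ : IsResolventSol α h lam F ω₂) :
    IsResolventSol α h lam (fun _ => 0) (fun y => ω₁ y - ω₂ y) := by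
  have h := resSol_add h₁ (resSol_smul h₂ (-1))
  refine ⟨?_, ?_, ?_⟩
  · have := h.1; simpa [sub_eq_add_neg] using this
  · obtain ⟨C, hC⟩ := h.2.1; exact ⟨C, fun y => by simpa [sub_eq_add_neg] using hC y⟩
  · intro y
    have := h.2.2 y
    have hfun : (fun y => ω₁ y + -1 * ω₂ y) = fun y => ω₁ y - ω₂ y := by funext t; ring
    rw [hfun] at this
    simpa using this

/-- **Uniqueness transfer**: under `ResolventUniqueAt`, two Gaussian-class solutions with the same source
coincide. [folklore] -/
theorem resSol_unique {α h : ℝ} {lam : ℂ} {F ω₁ ω₂ : ℝ → ℂ} (hU : ResolventUniqueAt α h lam)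
    (h₁ : IsResolventSol α h lam F ω₁) (h₂ : IsResolventSol α h lam F ω₂) : ω₁ = ω₂ := by
  funext y
  have := hU _ (resSol_sub_same h₁ h₂) y
  exact sub_eq_zero.1 this

/-- **Resolvent identity** at the level of solutions: if `u` solves at `λ` and `v` at `λ'` with the same
source, then `u - v` solves at `λ` with source `(λ' - λ) v`. [folklore] -/
theorem resSol_sub_param {α h : ℝ} {lam lam' : ℂ} {G u v : ℝ → ℂ}
    (hu : IsResolventSol α h lam G u) (hv : IsResolventSol α h lam' G v) :
    IsResolventSol α h lam (fun y => (lam' - lam) * v y) (fun y => u y - v y) := by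
  -- `v` solves at `λ` with source `G + (λ - λ') v`... assemble via add/smul
  have hv' : IsResolventSol α h lam (fun y => G y - (lam' - lam) * v y) v := by
    obtain ⟨hc, hb, he⟩ := hv
    refine ⟨hc, hb, fun y => ?_⟩
    have := he y
    linear_combination this
  have := resSol_add hu (resSol_smul hv' (-1))
  refine ⟨?_, ?_, ?_⟩
  · simpa [sub_eq_add_neg] using this.1
  · obtain ⟨C, hC⟩ := this.2.1; exact ⟨C, fun y => by simpa [sub_eq_add_neg] using hC y⟩
  · intro y
    have e := this.2.2 y
    have hfun : (fun y => u y + -1 * v y) = fun y => u y - v y := by funext t; ring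
    rw [hfun] at e
    rw [e]; ring

/-- **Decomposition** `ω = F/(λ+iU) + h·ou(ω)/(λ+iU)`: the resolvent is multiplication by `(λ+iU)⁻¹`
up to `O(h)` second-order terms. [folklore] -/
theorem resSol_decomp {α h : ℝ} {lam : ℂ} {F ω : ℝ → ℂ} (hs : IsResolventSol α h lam F ω)
    (hlam : 0 < lam.re) (y : ℝ) :
    ω y - F y / (lam + I * U y) = (h : ℂ) * ou α ω y / (lam + I * U y) := by
  have hne := lam_add_ne_zero hlam y
  have := hs.2.2 y
  field_simp
  linear_combination this

/-! ## §C Gaussian decay of the derivative of a resolvent solution -/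

/-- A Gaussian bound constant is nonnegative. [folklore] -/
theorem GaussBound.nonneg {F : ℝ → ℂ} {C : ℝ} (hF : GaussBound F C) : 0 ≤ C := by
  have h := hF 0
  have : (0 : ℝ) ≤ C * Real.exp (-(0 : ℝ) ^ 2 / 4) := (norm_nonneg _).trans h
  simpa using this

/-- `e^{-t²/2} ≤ e^{-t²/4}`. [folklore] -/
theorem exp_half_le_quarter (t : ℝ) : Real.exp (-(t ^ 2) / 2) ≤ Real.exp (-(t ^ 2) / 4) := by
  rw [Real.exp_le_exp]; nlinarith [sq_nonneg t]

/-- **Derivative decay.** A Gaussian-class `C²` solution of the resolvent equation with `h ≠ 0` and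
Gaussian-class source has `‖ω'(t)‖ ≤ D (1+|t|)² e^{-t²/4}`: with `P = e^{t²/2} ω'` one has
`P' = e^{t²/2}(ω'' + tω')` and `ω'' + tω' = ((λ+iU)ω - F)/h - (1-α²)ω` is Gaussian-small. [folklore] -/
theorem resSol_deriv_decay {α h : ℝ} {lam : ℂ} {F ω : ℝ → ℂ} (hs : IsResolventSol α h lam F ω) (hh : h ≠ 0) {C_F : ℝ} (hF : GaussBound F C_F) : ∃ D : ℝ, 0 ≤ D ∧ ∀ t : ℝ, ‖deriv ω t‖ ≤ D * (1 + |t|) ^ 2 * Real.exp (-(t ^ 2) / 4) := by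
  obtain ⟨hc, ⟨C, hC⟩, he⟩ := hs
  have hC0 : 0 ≤ C := GaussBound.nonneg hC
  have hCF0 : 0 ≤ C_F := GaussBound.nonneg hF
  have hd : Differentiable ℝ ω := hc.differentiable (by norm_num)
  have hc1 : ContDiff ℝ 1 (deriv ω) := (show ContDiff ℝ (1 + 1) ω from hc).deriv'
  have hd' : Differentiable ℝ (deriv ω) := hc1.differentiable (by norm_num)
  have hcont2 : Continuous (iteratedDeriv 2 ω) := by
    rw [iteratedDeriv_two_eq]; exact hc1.continuous_deriv le_rfl
  -- the Gaussian-small right-hand side `G = ω'' + t ω'`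
  set G : ℝ → ℂ := fun t => iteratedDeriv 2 ω t + (t : ℂ) * deriv ω t with hG
  have hGcont : Continuous G := hcont2.add (continuous_ofReal.mul hd'.continuous)
  set CG : ℝ := ((‖lam‖ + 1) * C + C_F) / |h| + (1 + α ^ 2) * C with hCG
  have hCG0 : 0 ≤ CG := by positivity
  have hGbound : ∀ t, ‖G t‖ ≤ CG * (1 + |t|) * Real.exp (-(t ^ 2) / 4) := by
    intro t
    have heq := he t
    have hne : (h : ℂ) ≠ 0 := by exact_mod_cast hh
    have key : (h : ℂ) * (G t + (1 - (α : ℂ) ^ 2) * ω t) = (lam + I * U t) * ω t - F t := by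
      simp only [hG, ou] at heq ⊢; linear_combination -heq
    have hGt : G t = ((lam + I * U t) * ω t - F t) / h - (1 - (α : ℂ) ^ 2) * ω t := by
      rw [← key]; field_simp; ring
    rw [hGt]
    have e0 : 0 < Real.exp (-(t ^ 2) / 4) := Real.exp_pos _
    have h1 : ‖(lam + I * U t) * ω t‖ ≤ (‖lam‖ + |t|) * (C * Real.exp (-(t ^ 2) / 4)) := by
      rw [norm_mul]; exact mul_le_mul (norm_lam_add_le lam t) (hC t) (norm_nonneg _) (by positivity)
    have h2 : ‖F t‖ ≤ C_F * Real.exp (-(t ^ 2) / 4) := hF t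
    have h3 : ‖(1 - (α : ℂ) ^ 2) * ω t‖ ≤ (1 + α ^ 2) * (C * Real.exp (-(t ^ 2) / 4)) := by
      rw [norm_mul]
      refine mul_le_mul ?_ (hC t) (norm_nonneg _) (by positivity)
      calc ‖(1 - (α : ℂ) ^ 2)‖ ≤ ‖(1 : ℂ)‖ + ‖(α : ℂ) ^ 2‖ := norm_sub_le _ _
        _ = 1 + α ^ 2 := by rw [norm_one, norm_pow, Complex.norm_real, Real.norm_eq_abs, sq_abs]
    calc ‖((lam + I * U t) * ω t - F t) / h - (1 - (α : ℂ) ^ 2) * ω t‖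
        ≤ ‖((lam + I * U t) * ω t - F t) / h‖ + ‖(1 - (α : ℂ) ^ 2) * ω t‖ := norm_sub_le _ _
      _ ≤ ((‖lam‖ + |t|) * (C * Real.exp (-(t ^ 2) / 4)) + C_F * Real.exp (-(t ^ 2) / 4)) / |h| +
            (1 + α ^ 2) * (C * Real.exp (-(t ^ 2) / 4)) := by
          refine add_le_add ?_ h3
          rw [norm_div, Complex.norm_real, Real.norm_eq_abs]
          gcongr
          exact (norm_sub_le _ _).trans (add_le_add h1 h2)
      _ ≤ CG * (1 + |t|) * Real.exp (-(t ^ 2) / 4) := by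
          rw [hCG]
          have hh0 : 0 < |h| := abs_pos.2 hh
          have ht0 : 0 ≤ |t| := abs_nonneg t
          -- compare the coefficients of the common factor `exp(-t²/4)`
          have piece1 : ((‖lam‖ + |t|) * C + C_F) / |h| ≤ ((‖lam‖ + 1) * C + C_F) * (1 + |t|) / |h| := by
            apply div_le_div_of_nonneg_right _ hh0.le
            have : 0 ≤ ‖lam‖ * C * |t| + C + C_F * |t| := by positivity
            nlinarith [this]
          have piece2 : (1 + α ^ 2) * C ≤ (1 + α ^ 2) * C * (1 + |t|) :=
            le_mul_of_one_le_right (by positivity) (by linarith)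
          have key : ((‖lam‖ + |t|) * C + C_F) / |h| + (1 + α ^ 2) * C ≤
              (((‖lam‖ + 1) * C + C_F) / |h| + (1 + α ^ 2) * C) * (1 + |t|) := by
            have e : (((‖lam‖ + 1) * C + C_F) / |h| + (1 + α ^ 2) * C) * (1 + |t|) =
                ((‖lam‖ + 1) * C + C_F) * (1 + |t|) / |h| + (1 + α ^ 2) * C * (1 + |t|) := by ring
            rw [e]
            exact add_le_add piece1 piece2
          have := mul_le_mul_of_nonneg_right key e0.le
          refine le_trans (le_of_eq ?_) this
          ring
  -- `P = e^{t²/2} ω'` and its derivative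
  set P : ℝ → ℂ := fun t => (Real.exp (t ^ 2 / 2) : ℂ) * deriv ω t with hP
  have hPder : ∀ t, HasDerivAt P ((Real.exp (t ^ 2 / 2) : ℂ) * G t) t := by
    intro t
    have h1 : HasDerivAt (fun t : ℝ => Real.exp (t ^ 2 / 2)) (Real.exp (t ^ 2 / 2) * t) t := by
      have := ((hasDerivAt_pow 2 t).div_const 2).exp
      convert this using 1; ring
    have h1c : HasDerivAt (fun t : ℝ => (Real.exp (t ^ 2 / 2) : ℂ)) ((Real.exp (t ^ 2 / 2) * t : ℝ) : ℂ) t :=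
      h1.ofReal_comp
    have h2 : HasDerivAt (deriv ω) (iteratedDeriv 2 ω t) t := by
      rw [iteratedDeriv_two_eq]; exact (hd' t).hasDerivAt
    have := h1c.mul h2
    refine this.congr_deriv ?_
    simp only [hG]; push_cast; ring
  have hPcont' : Continuous fun t => (Real.exp (t ^ 2 / 2) : ℂ) * G t := by fun_prop
  -- FTC on `[0, t]`
  have hFTC : ∀ t, P t - P 0 = ∫ s in (0:ℝ)..t, (Real.exp (s ^ 2 / 2) : ℂ) * G s := fun t =>
    (intervalIntegral.integral_eq_sub_of_hasDerivAt (fun s _ => hPder s) (hPcont'.intervalIntegrable _ _)).symm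
  -- bound of the integral
  have hint : ∀ t, ‖∫ s in (0:ℝ)..t, (Real.exp (s ^ 2 / 2) : ℂ) * G s‖ ≤
      CG * (1 + |t|) * Real.exp (t ^ 2 / 4) * |t| := by
    intro t
    have := intervalIntegral.norm_integral_le_of_norm_le_const (a := (0:ℝ)) (b := t)
      (C := CG * (1 + |t|) * Real.exp (t ^ 2 / 4)) (f := fun s => (Real.exp (s ^ 2 / 2) : ℂ) * G s) ?_
    · simpa using this
    intro s hs
    have hs' : |s| ≤ |t| := by
      rcases le_total 0 t with ht | ht
      · rw [Set.uIoc_of_le ht] at hs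
        rw [abs_of_nonneg (le_of_lt hs.1), abs_of_nonneg ht]; exact hs.2
      · rw [Set.uIoc_of_ge ht] at hs
        rw [abs_of_nonpos hs.2, abs_of_nonpos ht]; linarith [hs.1]
    rw [norm_mul, Complex.norm_real, Real.norm_of_nonneg (Real.exp_pos _).le]
    calc Real.exp (s ^ 2 / 2) * ‖G s‖ ≤ Real.exp (s ^ 2 / 2) * (CG * (1 + |s|) * Real.exp (-(s ^ 2) / 4)) :=
          mul_le_mul_of_nonneg_left (hGbound s) (Real.exp_pos _).le
      _ = CG * (1 + |s|) * Real.exp (s ^ 2 / 4) := by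
          rw [show Real.exp (s ^ 2 / 2) * (CG * (1 + |s|) * Real.exp (-(s ^ 2) / 4)) =
            CG * (1 + |s|) * (Real.exp (s ^ 2 / 2) * Real.exp (-(s ^ 2) / 4)) by ring, ← Real.exp_add]
          congr 2; ring
      _ ≤ CG * (1 + |t|) * Real.exp (t ^ 2 / 4) := by
          have hsq : s ^ 2 ≤ t ^ 2 := by nlinarith [abs_nonneg s, sq_abs s, sq_abs t]
          gcongr
  refine ⟨‖deriv ω 0‖ + CG, by positivity, fun t => ?_⟩
  have hPt : ‖P t‖ ≤ ‖deriv ω 0‖ + CG * (1 + |t|) * Real.exp (t ^ 2 / 4) * |t| := by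
    have : P t = P 0 + ∫ s in (0:ℝ)..t, (Real.exp (s ^ 2 / 2) : ℂ) * G s := by rw [← hFTC t]; ring
    rw [this]
    have hP0 : ‖P 0‖ = ‖deriv ω 0‖ := by simp [hP]
    calc ‖P 0 + ∫ s in (0:ℝ)..t, (Real.exp (s ^ 2 / 2) : ℂ) * G s‖
        ≤ ‖P 0‖ + ‖∫ s in (0:ℝ)..t, (Real.exp (s ^ 2 / 2) : ℂ) * G s‖ := norm_add_le _ _
      _ ≤ ‖deriv ω 0‖ + CG * (1 + |t|) * Real.exp (t ^ 2 / 4) * |t| := by rw [hP0]; exact add_le_add le_rfl (hint t)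
  have hωt : deriv ω t = (Real.exp (-(t ^ 2) / 2) : ℂ) * P t := by
    simp only [hP]
    rw [← mul_assoc, ← Complex.ofReal_mul, ← Real.exp_add, show -(t ^ 2) / 2 + t ^ 2 / 2 = 0 by ring,
      Real.exp_zero, Complex.ofReal_one, one_mul]
  rw [hωt, norm_mul, Complex.norm_real, Real.norm_of_nonneg (Real.exp_pos _).le]
  have e1 : Real.exp (-(t ^ 2) / 2) * Real.exp (t ^ 2 / 4) = Real.exp (-(t ^ 2) / 4) := by
    rw [← Real.exp_add]; congr 1; ring
  have ht0 : 0 ≤ |t| := abs_nonneg t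
  calc Real.exp (-(t ^ 2) / 2) * ‖P t‖
      ≤ Real.exp (-(t ^ 2) / 2) * (‖deriv ω 0‖ + CG * (1 + |t|) * Real.exp (t ^ 2 / 4) * |t|) :=
        mul_le_mul_of_nonneg_left hPt (Real.exp_pos _).le
    _ = ‖deriv ω 0‖ * Real.exp (-(t ^ 2) / 2) + CG * ((1 + |t|) * |t|) * Real.exp (-(t ^ 2) / 4) := by
        rw [← e1]; ring
    _ ≤ ‖deriv ω 0‖ * ((1 + |t|) ^ 2 * Real.exp (-(t ^ 2) / 4)) + CG * (1 + |t|) ^ 2 * Real.exp (-(t ^ 2) / 4) := by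
        gcongr
        · calc Real.exp (-(t ^ 2) / 2) ≤ Real.exp (-(t ^ 2) / 4) := exp_half_le_quarter t
            _ = 1 * Real.exp (-(t ^ 2) / 4) := (one_mul _).symm
            _ ≤ (1 + |t|) ^ 2 * Real.exp (-(t ^ 2) / 4) := by gcongr; nlinarith
        · nlinarith
    _ = (‖deriv ω 0‖ + CG) * (1 + |t|) ^ 2 * Real.exp (-(t ^ 2) / 4) := by ring

end Summit.AnomalousDissipation.AnomalousDissipation.Theorems.BurgersLayerKH.Sheet.Strained

end
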